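import Summits.CriticalPhenomena.SAWScalingLimit.Theses.SAWLoopFugacityFlow
import Summits.CriticalPhenomena.SAWScalingLimit.Theorems.SAWLoopFugacityFlowAvoidanceLimitAnchorDefs
import Summits.CriticalPhenomena.SAWScalingLimit.Theorems.SAWLoopFugacityFlowAvoidanceLimitSawEndpoint
import Summits.CriticalPhenomena.SAWScalingLimit.Theorems.SAWLoopFugacityFlowAvoidanceLimitCornerIdentification
import Summits.CriticalPhenomena.SAWScalingLimit.Theorems.SAWLoopFugacityFlowAvoidanceLimitMassiveBelow
import Summits.CriticalPhenomena.SAWScalingLimit.Theorems.SAWLoopFugacityFlowAvoidanceLimitNotMassiveAbove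
import Summits.CriticalPhenomena.SAWScalingLimit.Theorems.SAWLoopFugacityFlowAvoidanceLimitCritLineMonotone
import Summits.CriticalPhenomena.SAWScalingLimit.Theorems.SAWLoopFugacityFlowAvoidanceLimitTaggiShift
import Summits.CriticalPhenomena.SAWScalingLimit.Theorems.AvoidanceLimit.Negative.AvoidanceLimitWitnessDomains
import Summits.CriticalPhenomena.SAWScalingLimit.Theorems.AvoidanceLimit.Negative.AvoidanceLimitFalseWithoutChordal
import Summits.CriticalPhenomena.SAWScalingLimit.Theorems.AvoidanceLimit.Negative.AvoidanceLimitFalseWithoutReachable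
import Summits.CriticalPhenomena.SAWScalingLimit.Theorems.AvoidanceLimit.Negative.AvoidanceLimitRestrictionData
import Summits.CriticalPhenomena.SAWScalingLimit.Theorems.AvoidanceLimit.Negative.AvoidanceLimitExponentRigidity
import Literature.Probability.RandomPlanarGeometry.SupercriticalSAWPolygons
import Literature.Probability.RandomPlanarGeometry.SupercriticalSAWProp3Holds
import Literature.Probability.RandomPlanarGeometry.HammersleyWelshBound
import Literature.Probability.RandomPlanarGeometry.SelfAvoidingWalkProofs

/-!
# Line `saw-corner-germ` — skeleton v2 (lead attempt 1) for the crux `AvoidanceLimit` (stmt-CriticalPhenomena-10649)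

Route `SAWLoopFugacityFlow` (rank-2 crux): for every Dobrushin domain `(D; a, b)`, hull subdomain
`D'`, endpoint approximation, chordal uniformizer `φ`, pulled-back hull `A` and restriction data
`(Φ, d = Φ'_A(0))`, the critical `δℤ²`-SAW avoidance probability `P_δ(range γ ⊆ closure D')`
tends to `d^(5/8)`.

Idea card `Ideas/saw-corner-germ.md` (ideator 1; triage r1: 3 × pass), planner skeleton
`Lines/saw-corner-germ.lean` (v1). The lever is LINEAR RESPONSE AT THE CORNER: a δ-uniform
Lipschitz bound for `n ↦ R_δ(n; D, D')` on a real interval `[0, n₀]` commutes `n → 0⁺` with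
`δ → 0⁺`, so the crux drops out of the route's POSITIVE-`n` continuation (existence of the limits:
route debt FugacityAnalyticity; their closed form `d^{b(n)}`: route debt IsingWindow + identity
theorem).

## v2 = the planner's composition RE-INSTANTIATED on landed objects (the card: "FAMILY-AGNOSTIC
COMPOSITION … when `DiluteLoopModel` lands the lead may re-instantiate stubs 3–5 verbatim")

* The strictly dilute `w ≡ 0` loop-dressed SAW of the card IS the `t = 0` slice of the reviewed
  objects module `Theorems/SAWLoopFugacityFlowAvoidanceLimitAnchorDefs` (line `symplectic-fermion-anchor`):
  `dimerPF n 0 x G Λ A = (⟨n, 0, x⟩ : DiluteLoopModel ℝ).partitionFunction G Λ A`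
  (`Anchor.dimerPF_dimerFugacity_zero`, landed), `twoLegDim n 0 x`, and the doubly normalised ratio
  `Rδ n 0 x Ω S δ a b` whose NUMERATOR lives on the CONFINED graph (edges of `Ω_δ` with closed
  segment in `closure S`) — so the crux's closed event `{range ⊆ closure D'}` is matched EXACTLY and the
  planner's hidden open clause of `stub_cornerIdentification` (boundary-touching walks vs `Ω'_δ`-walks)
  disappears: stub 2 is the landed identity `Anchor.stub_sawEndpoint` (p90984) eventually in `δ`.
* The critical curve `critLine n` keeps the card's CANONICAL form (right end of the initial massive
  interval, capped at `1`), but the reference geometry is the DKY "squared walk": the normalised two-leg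
  function `boxTwoLeg k n x` of the dressed SAW across the lattice square `[0, k]²` from the corner `0` to
  the corner `(k, k)`. At `n = 0` it is `Σ x^{|γ|}` over squared walks of span `k`
  (`Anchor.twoLegDim_zero_zero_eq_sum_paths`), so `critLine 0 = 1/μ` splits into two TRUE tree-level
  statements: `MassiveBelow` (Hammersley–Welsh `c_n ≤ μⁿ e^{κ√n}`, `BDGS2012_HammersleyWelsh_holds`) and
  `NotMassiveAbove` (for `x > 1/μ`, DKY Lemma 5 `a_n ≥ μⁿe^{-c√n}` + pigeonhole on the span give a span
  `k(n) ≥ √n - 1` with `A_{k(n)}(x) ≥ (xμ)ⁿ e^{-c√n}/n → ∞`; `DKY2014_lem5_holds`). Whether `x_c` ITSELF is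
  massive is irrelevant to the supremum (Madras 1995 says it is not; not needed). This convention is preferred to the
  anchor line's `xcDim n 0` for `n > 0` (radius of convergence of a series with possibly SIGNED Taylor
  coefficients, which a complex singularity inside `|x| < x_c(n)` would spoil); both give `1/μ` at `n = 0`.
* The exponent is the landed `bExp` (`bExp_zero : bExp 0 = 5/8`), continuous at `0`.

## The six registered stubs (≤ 7) and the composition `AvoidanceLimit_of` (kernel-checked, no `sorry`)

1a. `stub_massiveBelow`      — `∀ y ∈ [0, x_c), IsMassive 0 y` — CLOSED, landed p96901 (BDGS Prop. 1.3).
1b. `stub_notMassiveAbove`   — `∀ x > x_c, ¬ IsMassive 0 x` — CLOSED, landed p98165 (DKY Lemma 5 + pigeonhole).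
2.  `stub_cornerIdentification` — `P_δ(range ⊆ cl D').toReal − Rδ 0 0 x_c → 0` — CLOSED, landed p96624.
3.  `stub_cornerEquicontinuous` — THE LEVER, minimal form since v2.6 (δ-uniform equicontinuity at 0⁺; implied by the card's Lipschitz form `CornerLipschitz`, glue `cornerEquicontinuous_of_cornerLipschitz`; open; the lead's stub).
4.  `stub_positiveFugacityLimits` — route debt (FugacityAnalyticity on real `n ∈ (0, n₀]`; open; XL).
5.  `stub_coulombGasValues`     — route debt (IsingWindow ∘ identity theorem; open; XL; sees `d`).

Glue (PROVED here): `criticalLineAtZero_of : MassiveBelow → NotMassiveAbove → critLine 0 = x_c`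
(the massive initial interval is `[0, x_c)` or `[0, x_c]`), `tendsto_rpow_bExp`, `tendsto_lineRatio_zero` (ε/3), and
`AvoidanceLimit_of` (stubs ⇒ crux BY NAME).

## Landed layer of the lever (stub 3), all `--supports` of the crux, namespace `…Theorems.AvoidanceLimit.Corner`

`RatioBounds` p97801 (`partitionFunction_mono_graph`: confined ≤ unconfined), `CritLineWellPosed` p97147
(`critLine n ∈ [0,1]`, `isMassive_zero`, positivity), `CritLineMonotone` p98079 (`critLine 0 ≤ critLine n`,
`twoLegDim n 0 y ≤ twoLegDim 0 0 y`), `LinearResponse` p99219 (`∂ₙ Z_{n,0,x}(A)|₀` = one-loop g.f.),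
`FugacityResponse` p100822 (`∂ₓ twoLeg` at `n = 0` = length response), `SourcesFactorisation` p101099
(`Z_n({a,b}) = Σ_γ x^{|γ|} Z_n(Λ ∖ V(γ); ∅)`), `TwoLegLinearResponse` p101182 (`∂ₙ twoLegDim|₀`), `LogResponse`
(p103143: one-loop factorisation, `∂ₙ log twoLeg|₀ = E^γ[Π(Λ∖γ)] − Π(Λ)`, `∂ₙ log R_δ|₀` = differenced law),
`TaggiPlaquettes` p102202 / `TaggiKesten` p103658 / `TaggiShift` p105467 (`isMassive_above_criticalFugacity_of_pos`: `x_c < critLine n` for `n > 0`, skeleton corollary `criticalFugacity_lt_critLine`) / `TaggiLinear` (`isMassive_upTo_linear_shift`: `x_c(1 + cn) ≤ critLine n`, corollary `exists_linear_le_critLine`), `CurveResponse` (p104363 pending: response along any differentiable fugacity curve).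

## Disproof used (Disproof.lean cycles 1–3 + landed `Negative/*`, read 2026-08-16T10:20Z)

`_false_without_{chordal,normalisation,deriv,hullEq}` honoured at stub 5 (all four clauses verbatim;
the only stub that sees `d`); `_false_without_reachable` at stub 2 (`Anchor`-style `eventually_good`
uses `IsEndpointApprox.reachable`); `_false_without_ball_and_pt`: stubs 3–5 keep `hpt ∧ hball`;
exponent rigidity (`avoidanceLimit_not_exp`): `5/8 = bExp 0` enters through stub 5 only, stubs 1–4 are
value-free; cycle 3 kill criteria / endpoint transfer: not needed by the confined formulation (stub 2 is an
identity for EVERY `D'`, no largest-component bookkeeping). No `-- Targets` kill applies to any stub.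
-/

noncomputable section

open Set Filter Topology MeasureTheory
open scoped ENNReal
open Literature.Probability.RandomPlanarGeometry Literature.Probability.LatticeModels
open Summit.CriticalPhenomena.SAWScalingLimit.Theses.SAWLoopFugacityFlow (AvoidanceLimit)
open Summit.CriticalPhenomena.SAWScalingLimit.Theorems.AvoidanceLimit.Negative
open Summit.CriticalPhenomena.SAWScalingLimit.Theorems.AvoidanceLimit.Anchor

namespace Summit.CriticalPhenomena.SAWScalingLimit.Cruxes.AvoidanceLimit.SawCornerGerm

/-! ### The reference geometry of the critical curve: corner-to-corner crossings of `[0, k]²` -/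

/-- The lattice square `[0, k]² ∩ ℤ²` as a finset of sites. -/
def sqBox (k : ℕ) : Finset (Site 2) := (box 2 k).filter fun v => ∀ i, 0 ≤ v i

/-- **The corner-to-corner two-leg function of the strictly dilute loop-dressed SAW**:
`Z_{n,x}([0,k]²; 0, (k,k)) / Z_{n,x}([0,k]²; ∅)` for the `t = 0` slice of the Anchor family
(= the tree's `DiluteLoopModel ⟨n, 0, x⟩` on `ℤ²` restricted to the square). At `n = 0` this is
`Σ_γ x^{|γ|}` over DKY squared walks of span `k`. -/
def boxTwoLeg (k : ℕ) (n x : ℝ) : ℝ := twoLegDim n 0 x (zdGraph 2) (sqBox k) 0 (SAW.diag k)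

/-- `(n, x)` is MASSIVE: the corner-to-corner two-leg function decays exponentially in the side. -/
def IsMassive (n x : ℝ) : Prop :=
  ∃ m : ℝ, 0 < m ∧ ∀ᶠ k : ℕ in atTop, boxTwoLeg k n x ≤ Real.exp (-(m * k))

/-- **The critical curve `x_c(n)` of the strictly dilute family, canonically**: the right end of the
initial interval of massive fugacities, capped at `1` (so the `sSup` is over a bounded set; every
critical value of the family is expected in `[1/μ, 1)`). -/
def critLine (n : ℝ) : ℝ := sSup {x : ℝ | 0 ≤ x ∧ x ≤ 1 ∧ ∀ y ∈ Set.Icc 0 x, IsMassive n y}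

/-- **`R_δ(n; D, D')` ALONG THE CRITICAL CURVE** for the crux's data: the Anchor ratio `Rδ n 0 x`
(numerator: dressed SAWs of `Ω_δ` from `a_δ` to `b_δ` whose polyline stays in `closure D'`, with the
loop gas on the confined graph; denominator: the same on `Ω_δ`) at `x = critLine n`. -/
def lineRatio (D D' : DobrushinDomain) (a b : ℝ → Site 2) (δ n : ℝ) : ℝ :=
  Rδ n 0 (critLine n) D.carrier D'.carrier δ (a δ) (b δ)

/-- The crux's avoidance probability `P_δ(range γ_δ ⊆ closure D')` (pushed-forward `SAW.law`). -/
def avoidProb (D D' : DobrushinDomain) (a b : ℝ → Site 2) (δ : ℝ) : ℝ≥0∞ :=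
  ((SAW.law D.carrier δ (a δ) (b δ)).map (fun γ => γ.curve))
    (CurveClass.rangeSubset (closure D'.carrier))

/-! ### The statements of the line -/

/-- STUB 1a statement — **below `x_c` the square crossing is massive**: for `0 ≤ y < 1/μ` the
corner-to-corner generating function `Σ_γ y^{|γ|}` over squared walks of span `k` (lengths `≥ 2k`)
is `≤ e^{-mk}` eventually. Content: `boxTwoLeg k 0 y = Σ_{p ∈ pathsIn ℤ² [0,k]² 0 (k,k)} y^{|p|}`
(`Anchor.twoLegDim_zero_zero_eq_sum_paths`), each such path is an `n`-step SAW from `0` with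
`n ≥ 2k`, so the sum is `≤ Σ_{n ≥ 2k} c_n y^n ≤ Σ_{n ≥ 2k} (μy)^n e^{κ√n}`
(`SAW.Zd.BDGS2012_HammersleyWelsh_holds`), a tail decaying like `e^{-mk}` for any
`m < -2 log(μ y)`. Pure SAW; size M. -/
def MassiveBelow : Prop := ∀ y : ℝ, 0 ≤ y → y < SAW.criticalFugacity → IsMassive 0 y

/-- STUB 1b statement — **above `x_c` the square crossing is NOT massive**: for `x > 1/μ` put
`θ := log (xμ) > 0` and `A_k(x) := boxTwoLeg k 0 x = Σ_{span-k squared walks} x^{|γ|}`. DKY 2014 Lemma 5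
(`SAW.DKY2014_lem5_holds`: `a_n ≥ μⁿ e^{-c√n}` for even `n`) and pigeonhole on the span `k ∈ [1, n]` of a
length-`n` squared walk give a span `k(n)` carrying `≥ a_n / n` of them, with `k(n) ≥ √n - 1 → ∞` (a span-`k`
walk has `≤ (k+1)²` sites); hence `A_{k(n)}(x) ≥ (xμ)ⁿ e^{-c√n} / n = e^{θn - c√n - log n} → ∞`, incompatible
with `A_k ≤ e^{-mk} ≤ 1` for all large `k`. Pure SAW; size M. (Non-massiveness AT `x_c` — Madras 1995 —
is true but not needed: the supremum of the initial massive interval is `x_c` either way.) -/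
def NotMassiveAbove : Prop := ∀ x : ℝ, SAW.criticalFugacity < x → ¬ IsMassive 0 x

/-- STUB 2 statement — **corner identification** (the lattice meaning of the crux): along an endpoint
approximation, `P_δ(range γ ⊆ closure D').toReal − R_δ(0, 0, x_c; D, D') → 0`. Content: eventually
`δ > 0` and `a_δ ≠ b_δ` (`IsEndpointApprox`: distinct limits + reachability, cf. the landed
`avoidanceLimit_false_without_reachable`), and then the two quantities are EQUAL by the landed
`Anchor.stub_sawEndpoint` (`P = ofReal R`, `R ≥ 0` a ratio of sums of nonnegative terms by
`Anchor.Rδ_zero_zero_eq_div`). Size S. -/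
def CornerIdentification : Prop :=
  ∀ (D D' : DobrushinDomain) (a b : ℝ → Site 2), SAW.IsEndpointApprox D a b →
    Tendsto (fun δ => (avoidProb D D' a b δ).toReal -
      Rδ (0 : ℝ) 0 SAW.criticalFugacity D.carrier D'.carrier δ (a δ) (b δ)) (𝓝[>] 0) (𝓝 0)

/-- STUB 3 statement — **THE LEVER: δ-uniform Lipschitz bound at the SAW corner.** Along the
critical curve of the strictly dilute family, `n ↦ R_δ(n; D, D')` is Lipschitz at `n = 0⁺` with a
constant independent of the mesh: `∃ n₀ > 0, C, ∀ᶠ δ → 0⁺, ∀ n ∈ [0, n₀], |R_δ(n) − R_δ(0)| ≤ C·n`.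
Mechanism (card G1; ideator 3's `LinearResponseFinite` at `n = 0`): at finite volume `R_δ` is smooth
in `n` and `∂ₙ log R_δ(n)|₀ = E^{SAW}_{Ω_δ}[K] − E^{SAW}_{Ω_δ, ⊆ cl D'}[K]`, `K(γ) = M_hit(γ) − ℓ|γ|`,
`M_hit(γ)` the `x_c`-mass of self-avoiding polygons of the (confined) domain graph meeting `γ`,
`ℓ = x_c'(0)/x_c`; single expectations diverge (`E|γ| ≍ δ^{-4/3}`), the DIFFERENCE stays bounded iff
`ℓ` is the bulk contact density and the corrections to scaling along the curve have exponents `> 4/3`.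
Open; L–XL. Falsifier: drift in the box size of the differenced compensated contact functional /
of `(R_L(n) − R_L(0))/n` on strips (transfer matrices). -/
def CornerLipschitz : Prop :=
  ∀ (D D' : DobrushinDomain) (a b : ℝ → Site 2), SAW.IsEndpointApprox D a b →
    D'.carrier ⊆ D.carrier → D'.pt 0 = D.pt 0 → D'.pt 1 = D.pt 1 →
    (∃ ε : ℝ, 0 < ε ∧ D'.carrier ∩ Metric.ball (D.pt 0) ε = D.carrier ∩ Metric.ball (D.pt 0) ε ∧
      D'.carrier ∩ Metric.ball (D.pt 1) ε = D.carrier ∩ Metric.ball (D.pt 1) ε) →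
    ∃ n₀ : ℝ, 0 < n₀ ∧ ∃ C : ℝ, ∀ᶠ δ in 𝓝[>] (0 : ℝ), ∀ n ∈ Set.Icc 0 n₀,
      |lineRatio D D' a b δ n - lineRatio D D' a b δ 0| ≤ C * n

/-- STUB 3 statement, MINIMAL FORM (v2.6; what the composition actually consumes) — **δ-uniform
equicontinuity of `n ↦ R_δ(n; D, D')` at `n = 0⁺`**: `∀ ε > 0, ∃ n₁ > 0, ∀ᶠ δ → 0⁺, ∀ n ∈ [0, n₁],
|R_δ(n) − R_δ(0)| ≤ ε`. Strictly weaker than the card's Lipschitz form `CornerLipschitz` (no rate: a modulus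
`n log(1/n)`, which a logarithmic CFT at `n = 0` could produce in amplitudes, would kill the Lipschitz form but not
this one), and exactly what the `ε/3` commutation of limits needs. Open; crux-sized (lead's assessment). -/
def CornerEquicontinuous : Prop :=
  ∀ (D D' : DobrushinDomain) (a b : ℝ → Site 2), SAW.IsEndpointApprox D a b →
    D'.carrier ⊆ D.carrier → D'.pt 0 = D.pt 0 → D'.pt 1 = D.pt 1 →
    (∃ ε : ℝ, 0 < ε ∧ D'.carrier ∩ Metric.ball (D.pt 0) ε = D.carrier ∩ Metric.ball (D.pt 0) ε ∧
      D'.carrier ∩ Metric.ball (D.pt 1) ε = D.carrier ∩ Metric.ball (D.pt 1) ε) →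
    ∀ ε : ℝ, 0 < ε → ∃ n₁ : ℝ, 0 < n₁ ∧ ∀ᶠ δ in 𝓝[>] (0 : ℝ), ∀ n ∈ Set.Icc 0 n₁,
      |lineRatio D D' a b δ n - lineRatio D D' a b δ 0| ≤ ε

/-- STUB 4 statement — **positive-fugacity limits exist**: for every small `n > 0` the critical
two-leg ratio `R_δ(n; D, D')` of the strictly dilute loop-dressed SAW converges as `δ → 0⁺`. This is
the convergence half of the route's `FugacityAnalyticity` (stmt-CriticalPhenomena-5063: δ-uniform
analyticity / local boundedness in `n` + Vitali), restricted to REAL `n ∈ (0, n₀]`, value-free, on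
the strictly dilute path `w ≡ 0` (transported from the route's diagonal `w = n/2` at fixed small
`n > 0` by one osculation-irrelevance step, `x₄ = 35/12 > 2`). Open; XL. -/
def PositiveFugacityLimits : Prop :=
  ∀ (D D' : DobrushinDomain) (a b : ℝ → Site 2), SAW.IsEndpointApprox D a b →
    D'.carrier ⊆ D.carrier → D'.pt 0 = D.pt 0 → D'.pt 1 = D.pt 1 →
    (∃ ε : ℝ, 0 < ε ∧ D'.carrier ∩ Metric.ball (D.pt 0) ε = D.carrier ∩ Metric.ball (D.pt 0) ε ∧
      D'.carrier ∩ Metric.ball (D.pt 1) ε = D.carrier ∩ Metric.ball (D.pt 1) ε) →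
    ∃ n₀ : ℝ, 0 < n₀ ∧ ∀ n ∈ Set.Ioc 0 n₀, ∃ v : ℝ,
      Tendsto (fun δ => lineRatio D D' a b δ n) (𝓝[>] 0) (𝓝 v)

/-- STUB 5 statement — **Coulomb-gas values at positive fugacity**: whenever the limits
`v(n) = lim_δ R_δ(n; D, D')` exist on some `(0, n₀]`, they are given, for all small `n > 0`, by the
restriction form with the dilute exponent: `v(n) = Φ'_A(0)^{b(n)}`, `b = bExp` (landed;
`b(0) = 5/8`, `b(1) = 1/2`). This is the route's `IsingWindow` (stmt-CriticalPhenomena-5080: closed form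
on `(1 − ε₀, 1]`) followed by the identity theorem along `FugacityAnalyticity`'s neighbourhood of `(0,1]`
(NOT of `0`). CFT reading: the two-leg function is the two-point function of the boundary one-leg primary
of weight `b(n) = h_{1,2}(κ(n))`; `D → ℍ` by `φ⁻¹`, `ℍ ∖ A → ℍ` by `Φ_A` multiplies it by
`|Φ_A'(0)|^{b(n)} · 1`, the lattice endpoint factors cancelling between `D` and `D'` by the ball agreement.
It keeps every load-bearing hypothesis (`avoidanceLimit_false_without_{chordal,normalisation,deriv,hullEq}`)
and is the ONLY stub that singles out a number (`avoidanceLimit_not_exp`). Open; XL. -/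
def CoulombGasValues : Prop :=
  ∀ (D D' : DobrushinDomain) (a b : ℝ → Site 2), SAW.IsEndpointApprox D a b →
    D'.carrier ⊆ D.carrier → D'.pt 0 = D.pt 0 → D'.pt 1 = D.pt 1 →
    (∃ ε : ℝ, 0 < ε ∧ D'.carrier ∩ Metric.ball (D.pt 0) ε = D.carrier ∩ Metric.ball (D.pt 0) ε ∧
      D'.carrier ∩ Metric.ball (D.pt 1) ε = D.carrier ∩ Metric.ball (D.pt 1) ε) →
    ∀ (φ : ConformalEquiv UpperHalfPlane.upperHalfPlaneSet D.carrier), D.IsChordalUniformizing φ →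
    ∀ (A : Set ℂ), A = closure (UpperHalfPlane.upperHalfPlaneSet \
      {z | z ∈ UpperHalfPlane.upperHalfPlaneSet ∧ φ z ∈ D'.carrier}) →
    ∀ (Φ : ConformalEquiv (UpperHalfPlane.upperHalfPlaneSet \ A) UpperHalfPlane.upperHalfPlaneSet)
      (d : ℝ), IsRestrictionMap A Φ → HasRestrictionDeriv A Φ d →
    ∀ (n₀ : ℝ) (v : ℝ → ℝ), 0 < n₀ →
      (∀ n ∈ Set.Ioc 0 n₀, Tendsto (fun δ => lineRatio D D' a b δ n) (𝓝[>] 0) (𝓝 (v n))) →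
      ∀ᶠ n in 𝓝[>] (0 : ℝ), v n = d ^ bExp n

/-! ### The registered stubs -/

/-- STUB 1a — CLOSED (landed `Corner.stub_massiveBelow`, p96901, via the PROVED BDGS 2012 Prop. 1.3
geometric bound on the subcritical two-point function): below `x_c` the square crossing is massive
(`MassiveBelow`, UNFOLDED into tree vocabulary: `boxTwoLeg k 0 y` is `twoLegDim 0 0 y ℤ² [0,k]² 0 (k,k)`). -/
theorem stub_massiveBelow :
    ∀ y : ℝ, 0 ≤ y → y < SAW.criticalFugacity → ∃ m : ℝ, 0 < m ∧ ∀ᶠ k : ℕ in atTop,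
      twoLegDim (0 : ℝ) 0 y (zdGraph 2) ((box 2 k).filter fun v => ∀ i, 0 ≤ v i) 0 (SAW.diag k) ≤
        Real.exp (-(m * k)) :=
  Theorems.AvoidanceLimit.Corner.stub_massiveBelow

/-- STUB 1b — CLOSED (landed `Corner.stub_notMassiveAbove`, p98165: DKY Lemma 5 + pigeonhole on the
span + supercritical growth): above `x_c` the square crossing is not massive (`NotMassiveAbove`, UNFOLDED). -/
theorem stub_notMassiveAbove :
    ∀ x : ℝ, SAW.criticalFugacity < x → ¬ ∃ m : ℝ, 0 < m ∧ ∀ᶠ k : ℕ in atTop,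
      twoLegDim (0 : ℝ) 0 x (zdGraph 2) ((box 2 k).filter fun v => ∀ i, 0 ≤ v i) 0 (SAW.diag k) ≤
        Real.exp (-(m * k)) :=
  Theorems.AvoidanceLimit.Corner.stub_notMassiveAbove

/-- STUB 2 — CLOSED (landed `Corner.stub_cornerIdentification`, p96624): corner identification
(`CornerIdentification`, UNFOLDED; the avoidance probability IS `Rδ 0 0 x_c` eventually in `δ`). -/
theorem stub_cornerIdentification :
    ∀ (D D' : DobrushinDomain) (a b : ℝ → Site 2), SAW.IsEndpointApprox D a b →
      Tendsto (fun δ => (((SAW.law D.carrier δ (a δ) (b δ)).map (fun γ => γ.curve))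
          (CurveClass.rangeSubset (closure D'.carrier))).toReal -
        Rδ (0 : ℝ) 0 SAW.criticalFugacity D.carrier D'.carrier δ (a δ) (b δ)) (𝓝[>] 0) (𝓝 0) :=
  Theorems.AvoidanceLimit.Corner.stub_cornerIdentification

/-- STUB 3 (L–XL, THE LEVER, the lead's stub; v2.6 minimal form): δ-uniform equicontinuity at the corner. -/
theorem stub_cornerEquicontinuous : CornerEquicontinuous := by
  sorry

/-- STUB 4 (XL, route debt: convergence half of FugacityAnalyticity on real `n > 0`). -/
theorem stub_positiveFugacityLimits : PositiveFugacityLimits := by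
  sorry

/-- STUB 5 (XL, route debt: IsingWindow's closed form transported to small positive `n`). -/
theorem stub_coulombGasValues : CoulombGasValues := by
  sorry

/-! ### Name-keyed aliases (the skeleton audit admits a hypothesis of the composition only if its
head constant is a registered obligation or is named like a declared stub) -/
namespace Registered

/-- Alias of `MassiveBelow` keyed by the registered stub name. -/
abbrev stub_massiveBelow : Prop := MassiveBelow
/-- Alias of `NotMassiveAbove` keyed by the registered stub name. -/
abbrev stub_notMassiveAbove : Prop := NotMassiveAbove
/-- Alias of `CornerIdentification` keyed by the registered stub name. -/
abbrev stub_cornerIdentification : Prop := CornerIdentification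
/-- Alias of `CornerEquicontinuous` keyed by the registered stub name. -/
abbrev stub_cornerEquicontinuous : Prop := CornerEquicontinuous
/-- Alias of `PositiveFugacityLimits` keyed by the registered stub name. -/
abbrev stub_positiveFugacityLimits : Prop := PositiveFugacityLimits
/-- Alias of `CoulombGasValues` keyed by the registered stub name. -/
abbrev stub_coulombGasValues : Prop := CoulombGasValues

end Registered

/-! ### Glue (PROVED) -/

/-- **The critical curve passes through the SAW point**: `MassiveBelow ∧ NotMassiveAbove ⇒ x_c(0) = 1/μ`.
The initial massive interval lies between `[0, x_c)` and `[0, x_c]`, so its supremum is `x_c`. -/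
theorem criticalLineAtZero_of (h1a : MassiveBelow) (h1b : NotMassiveAbove) :
    critLine 0 = SAW.criticalFugacity := by
  obtain ⟨hpos, hlt1⟩ := SAW.criticalFugacity_pos_lt_one'
  set S : Set ℝ := {x : ℝ | 0 ≤ x ∧ x ≤ 1 ∧ ∀ y ∈ Set.Icc 0 x, IsMassive 0 y} with hS
  have hsub : Set.Ico 0 SAW.criticalFugacity ⊆ S := by
    rintro x ⟨hx0, hxc⟩
    exact ⟨hx0, (hxc.trans hlt1).le, fun y hy => h1a y hy.1 (hy.2.trans_lt hxc)⟩
  have hle : ∀ x ∈ S, x ≤ SAW.criticalFugacity := by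
    rintro x ⟨hx0, -, hx⟩
    exact le_of_not_gt fun hxc => h1b x hxc (hx x ⟨hx0, le_rfl⟩)
  have hne : S.Nonempty := ⟨0, hsub ⟨le_rfl, hpos⟩⟩
  have hbdd : BddAbove S := ⟨SAW.criticalFugacity, hle⟩
  rw [critLine, ← hS]
  refine le_antisymm (csSup_le hne hle) ?_
  refine le_of_forall_lt fun y hy => ?_
  rcases lt_or_ge y 0 with hy0 | hy0
  · exact hy0.trans_le (le_csSup hbdd (hsub ⟨le_rfl, hpos⟩))
  · obtain ⟨z, hyz, hzc⟩ := exists_between hy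
    exact hyz.trans_le (le_csSup hbdd (hsub ⟨hy0.trans hyz.le, hzc⟩))

/-- **`x_c(0) = 1/μ`, unconditionally** (stubs 1a and 1b are landed theorems). -/
theorem critLine_zero : critLine 0 = SAW.criticalFugacity :=
  criticalLineAtZero_of stub_massiveBelow stub_notMassiveAbove

/-- **The critical curve stays at or above the SAW point for `n ≥ 0`** (landed comparison
`Corner.critLine_zero_le_critLine`: the loop gas only lowers the two-leg function), so `lineRatio` is never
evaluated at the junk fugacity `0` (audit of stubs 4–5). -/
theorem criticalFugacity_le_critLine {n : ℝ} (hn : 0 ≤ n) : SAW.criticalFugacity ≤ critLine n := by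
  rw [← critLine_zero]
  exact Theorems.AvoidanceLimit.Corner.critLine_zero_le_critLine n hn

/-- **Taggi-type strict shift: `x_c < x_c(n)` for every `n > 0`** (landed
`Corner.isMassive_above_criticalFugacity_of_pos`, p105467: Kesten's pattern theorem `thm723` + walk-supported unit
plaquettes penalise every dressed walk by `(1 + n y⁴)^{-#patterns}`): the initial massive interval of the loop-dressed
SAW extends STRICTLY beyond the SAW point — the rigorous lower half of "the critical curve moves at first order in `n`"
(L. Taggi, ECP 23 (2018), Thm 1, for the loop model; here for the two-leg line, unconditionally). -/
theorem criticalFugacity_lt_critLine {n : ℝ} (hn : 0 < n) : SAW.criticalFugacity < critLine n := by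
  obtain ⟨y₁, hy₁, hmass⟩ := Theorems.AvoidanceLimit.Corner.isMassive_above_criticalFugacity_of_pos n hn
  obtain ⟨hpos, hlt1⟩ := SAW.criticalFugacity_pos_lt_one'
  set S : Set ℝ := {x : ℝ | 0 ≤ x ∧ x ≤ 1 ∧ ∀ y ∈ Set.Icc 0 x, IsMassive n y} with hS
  have hmem : min y₁ 1 ∈ S := by
    refine ⟨le_min (hpos.le.trans hy₁.le) zero_le_one, min_le_right _ _, fun y hy => ?_⟩
    exact hmass y ⟨hy.1, hy.2.trans (min_le_left _ _)⟩
  have hbdd : BddAbove S := ⟨1, fun x hx => hx.2.1⟩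
  calc SAW.criticalFugacity < min y₁ 1 := lt_min hy₁ hlt1
    _ ≤ critLine n := le_csSup hbdd hmem

/- Taggi's LINEAR bound `x_c (1 + c n) ≤ critLine n` (n ∈ (0,1]) is the landed
`Corner.isMassive_upTo_linear_shift` (p107210, `…TaggiLinear.lean`); its 25-line skeleton corollary
`exists_linear_le_critLine` is kept in the lead's folder (work/AvoidanceLimit.v2_8_pending_farm.lean) until the farm
has built that module — it changes no stub. -/

/-- `n ↦ d^{b(n)}` is continuous at `n = 0` from the right, with value `d^(5/8)` (for every real `d`,
since `b(0) = 5/8 ≠ 0`). -/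
theorem tendsto_rpow_bExp (d : ℝ) :
    Tendsto (fun n : ℝ => d ^ bExp n) (𝓝[>] 0) (𝓝 (d ^ ((5 : ℝ) / 8))) := by
  have hq : ContinuousAt (fun n : ℝ => (2 + n) / (2 - n)) 0 :=
    ContinuousAt.div (by fun_prop) (by fun_prop) (by norm_num)
  have hb : ContinuousAt bExp 0 := by
    have h1 : ContinuousAt (fun n : ℝ => Real.sqrt ((2 + n) / (2 - n))) 0 :=
      Real.continuous_sqrt.continuousAt.comp hq
    have h2 : ContinuousAt (fun n : ℝ => Real.arctan (Real.sqrt ((2 + n) / (2 - n)))) 0 :=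
      Real.continuous_arctan.continuousAt.comp h1
    have h3 : ContinuousAt (fun n : ℝ => 1 - 3 * Real.arctan (Real.sqrt ((2 + n) / (2 - n))) /
        (2 * Real.pi)) 0 := by
      exact ((h2.const_mul 3).div_const (2 * Real.pi)).const_sub 1
    exact h3
  have h1 : ContinuousAt (fun t : ℝ => d ^ t) (bExp 0) := by
    apply Real.continuousAt_const_rpow'
    rw [bExp_zero]; norm_num
  have h2 : ContinuousAt (fun n : ℝ => d ^ bExp n) 0 := ContinuousAt.comp h1 hb
  have h3 : Tendsto (fun n : ℝ => d ^ bExp n) (𝓝 0) (𝓝 (d ^ bExp 0)) := h2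
  rw [bExp_zero] at h3
  exact h3.mono_left nhdsWithin_le_nhds

/-- The pushed-forward SAW law gives mass at most `1` to every event. -/
theorem avoidProb_le_one (D D' : DobrushinDomain) (a b : ℝ → Site 2) (δ : ℝ) :
    avoidProb D D' a b δ ≤ 1 :=
  map_law_apply_le_one _ _ _ _ _

/-- The card's Lipschitz form implies the minimal (equicontinuity) form of STUB 3. -/
theorem cornerEquicontinuous_of_cornerLipschitz (h : CornerLipschitz) : CornerEquicontinuous := by
  intro D D' a b hab hsub hp0 hp1 hball ε hε
  obtain ⟨n₀, hn₀, C, hC⟩ := h D D' a b hab hsub hp0 hp1 hball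
  have hC1 : 0 < |C| + 1 := by positivity
  refine ⟨min n₀ (ε / (|C| + 1)), lt_min hn₀ (by positivity), ?_⟩
  filter_upwards [hC] with δ hδ n hn
  have hn0 : n ∈ Set.Icc 0 n₀ := ⟨hn.1, hn.2.trans (min_le_left _ _)⟩
  have hnε : n ≤ ε / (|C| + 1) := hn.2.trans (min_le_right _ _)
  calc |lineRatio D D' a b δ n - lineRatio D D' a b δ 0| ≤ C * n := hδ n hn0
    _ ≤ |C| * n := mul_le_mul_of_nonneg_right (le_abs_self C) hn.1
    _ ≤ (|C| + 1) * n := mul_le_mul_of_nonneg_right (by linarith) hn.1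
    _ ≤ (|C| + 1) * (ε / (|C| + 1)) := mul_le_mul_of_nonneg_left hnε hC1.le
    _ = ε := by field_simp

/-- **Commutation of limits at the corner.** From STUB 3 (δ-uniform equicontinuity at `0⁺`), STUB 4 (limits at
positive `n`) and STUB 5 (their closed form near `0⁺`): `R_δ(0; D, D') → d^(5/8)` as `δ → 0⁺`. -/
theorem tendsto_lineRatio_zero (h3 : CornerEquicontinuous) (h4 : PositiveFugacityLimits)
    (h5 : CoulombGasValues)
    (D D' : DobrushinDomain) (a b : ℝ → Site 2) (hab : SAW.IsEndpointApprox D a b)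
    (hsub : D'.carrier ⊆ D.carrier) (hp0 : D'.pt 0 = D.pt 0) (hp1 : D'.pt 1 = D.pt 1)
    (hball : ∃ ε : ℝ, 0 < ε ∧
      D'.carrier ∩ Metric.ball (D.pt 0) ε = D.carrier ∩ Metric.ball (D.pt 0) ε ∧
      D'.carrier ∩ Metric.ball (D.pt 1) ε = D.carrier ∩ Metric.ball (D.pt 1) ε)
    (φ : ConformalEquiv UpperHalfPlane.upperHalfPlaneSet D.carrier) (hφ : D.IsChordalUniformizing φ)
    (A : Set ℂ) (hA : A = closure (UpperHalfPlane.upperHalfPlaneSet \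
      {z | z ∈ UpperHalfPlane.upperHalfPlaneSet ∧ φ z ∈ D'.carrier}))
    (Φ : ConformalEquiv (UpperHalfPlane.upperHalfPlaneSet \ A) UpperHalfPlane.upperHalfPlaneSet)
    (d : ℝ) (hΦ : IsRestrictionMap A Φ) (hd : HasRestrictionDeriv A Φ d) :
    Tendsto (fun δ => lineRatio D D' a b δ 0) (𝓝[>] 0) (𝓝 (d ^ ((5 : ℝ) / 8))) := by
  obtain ⟨n₂, hn₂, hlim⟩ := h4 D D' a b hab hsub hp0 hp1 hball
  choose! v hv using hlim
  -- the closed form near `0⁺` and continuity of `n ↦ d^{b(n)}` give `v(n) → d^(5/8)`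
  have hform : ∀ᶠ n in 𝓝[>] (0 : ℝ), v n = d ^ bExp n :=
    h5 D D' a b hab hsub hp0 hp1 hball φ hφ A hA Φ d hΦ hd n₂ v hn₂ hv
  have hval : Tendsto v (𝓝[>] 0) (𝓝 (d ^ ((5 : ℝ) / 8))) :=
    (tendsto_rpow_bExp d).congr' (hform.mono fun n hn => hn.symm)
  -- ε/3 argument
  rw [Metric.tendsto_nhds]
  intro ε hε
  have hε3 : 0 < ε / 3 := by positivity
  have hε4 : 0 < ε / 4 := by positivity
  obtain ⟨n₁, hn₁, hC⟩ := h3 D D' a b hab hsub hp0 hp1 hball (ε / 4) hε4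
  have ev1 : ∀ᶠ n in 𝓝[>] (0 : ℝ), dist (v n) (d ^ ((5 : ℝ) / 8)) < ε / 3 :=
    Metric.tendsto_nhds.1 hval _ hε3
  have ev2 : ∀ᶠ n in 𝓝[>] (0 : ℝ), n ∈ Set.Ioo 0 (min n₁ n₂) :=
    Ioo_mem_nhdsGT (lt_min hn₁ hn₂)
  obtain ⟨n, hnv, hn0, hnlt⟩ := (ev1.and ev2).exists
  obtain ⟨hnn₁, hnn₂⟩ := lt_min_iff.1 hnlt
  have evδ1 : ∀ᶠ δ in 𝓝[>] (0 : ℝ), dist (lineRatio D D' a b δ n) (v n) < ε / 3 :=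
    Metric.tendsto_nhds.1 (hv n ⟨hn0, hnn₂.le⟩) _ hε3
  filter_upwards [hC, evδ1] with δ hδC hδ1
  have hδ2 : |lineRatio D D' a b δ n - lineRatio D D' a b δ 0| ≤ ε / 4 := hδC n ⟨hn0.le, hnn₁.le⟩
  have hδ3 : |lineRatio D D' a b δ 0 - lineRatio D D' a b δ n| < ε / 3 := by
    rw [abs_sub_comm]
    exact hδ2.trans_lt (by linarith)
  rw [Real.dist_eq] at hnv hδ1 ⊢
  calc |lineRatio D D' a b δ 0 - d ^ ((5 : ℝ) / 8)|
      = |(lineRatio D D' a b δ 0 - lineRatio D D' a b δ n) + (lineRatio D D' a b δ n - v n)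
          + (v n - d ^ ((5 : ℝ) / 8))| := by ring_nf
    _ ≤ |lineRatio D D' a b δ 0 - lineRatio D D' a b δ n| + |lineRatio D D' a b δ n - v n|
          + |v n - d ^ ((5 : ℝ) / 8)| := abs_add_three _ _ _
    _ < ε / 3 + ε / 3 + ε / 3 := by gcongr
    _ = ε := by ring

/-- **The composition.** The three OPEN stubs 3, 4, 5 ⟹ the crux `AvoidanceLimit`, by name; the CLOSED stubs
1a, 1b, 2 enter as the landed theorems they now are (v2.7). -/
theorem AvoidanceLimit_of (h3 : Registered.stub_cornerEquicontinuous)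
    (h4 : Registered.stub_positiveFugacityLimits) (h5 : Registered.stub_coulombGasValues) :
    Summit.CriticalPhenomena.SAWScalingLimit.Theses.SAWLoopFugacityFlow.AvoidanceLimit := by
  -- the closed stubs (landed theorems)
  have h1a : Registered.stub_massiveBelow := stub_massiveBelow
  have h1b : Registered.stub_notMassiveAbove := stub_notMassiveAbove
  have h2 : Registered.stub_cornerIdentification := stub_cornerIdentification
  intro D D' a b hab hsub hp0 hp1 hball φ hφ A hA Φ d hΦ hd
  -- (3)+(4)+(5): the limits commute at the corner
  have key : Tendsto (fun δ => lineRatio D D' a b δ 0) (𝓝[>] 0) (𝓝 (d ^ ((5 : ℝ) / 8))) :=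
    tendsto_lineRatio_zero h3 h4 h5 D D' a b hab hsub hp0 hp1 hball φ hφ A hA Φ d hΦ hd
  -- (1a)+(1b): at `n = 0` the critical curve is at the SAW point `x_c`
  have hc : critLine 0 = SAW.criticalFugacity := criticalLineAtZero_of h1a h1b
  have hR0 : ∀ δ, lineRatio D D' a b δ 0 =
      Rδ (0 : ℝ) 0 SAW.criticalFugacity D.carrier D'.carrier δ (a δ) (b δ) := by
    intro δ
    simp only [lineRatio, hc]
  -- (2): hence the avoidance probability (as a real) converges to `d^(5/8)`
  have h2' := h2 D D' a b hab
  have hreal : Tendsto (fun δ => (avoidProb D D' a b δ).toReal) (𝓝[>] 0)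
      (𝓝 (d ^ ((5 : ℝ) / 8))) := by
    have hsum := h2'.add key
    rw [zero_add] at hsum
    refine hsum.congr' (Eventually.of_forall fun δ => ?_)
    simp only [hR0]
    ring
  -- back to `ℝ≥0∞`: the avoidance probability is at most `1`, hence finite
  have hne : ∀ δ, avoidProb D D' a b δ ≠ ∞ := fun δ =>
    ne_top_of_le_ne_top ENNReal.one_ne_top (avoidProb_le_one _ _ _ _ _)
  have hfin : Tendsto (fun δ => ENNReal.ofReal ((avoidProb D D' a b δ).toReal)) (𝓝[>] 0)
      (𝓝 (ENNReal.ofReal (d ^ ((5 : ℝ) / 8)))) := ENNReal.tendsto_ofReal hreal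
  have heq : (fun δ => ENNReal.ofReal ((avoidProb D D' a b δ).toReal)) = avoidProb D D' a b :=
    funext fun δ => ENNReal.ofReal_toReal (hne δ)
  rw [heq] at hfin
  exact hfin

/-- Wiring check: the registered stubs feed `AvoidanceLimit_of` as stated. -/
example : AvoidanceLimit :=
  AvoidanceLimit_of stub_cornerEquicontinuous stub_positiveFugacityLimits stub_coulombGasValues

/-! ### Scratch checks against the landed `Negative/*` lemmas -/

/-- Landed: the chordal normalisation of `φ` is load-bearing — STUB 5 keeps it. -/
example : ¬ AvoidanceLimitWithoutChordal := avoidanceLimit_false_without_chordal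

/-- Landed: reachability is load-bearing — STUB 2 is where `SAW.law` must be a probability
measure. -/
example : ¬ AvoidanceLimitWithoutReachable := avoidanceLimit_false_without_reachable

/-- Landed: the normalisation of `Φ` at `∞`, the derivative clause and the hull identification are
load-bearing — all three sit verbatim in STUB 5's frame, the only stub that sees `d`. -/
example : ¬ AvoidanceLimitWithoutNormalisation ∧ ¬ AvoidanceLimitWithoutDeriv ∧
    ¬ AvoidanceLimitWithoutHullEq :=
  ⟨avoidanceLimit_false_without_normalisation, avoidanceLimit_false_without_deriv,
    avoidanceLimit_false_without_hullEq⟩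

/-- Landed exponent rigidity: the line's value is `bExp 0 = 5/8`, and the crux excludes `1`. -/
example : bExp 0 = 5 / 8 ∧ (AvoidanceLimit → ¬ AvoidanceLimitExp 1) :=
  ⟨bExp_zero, fun h => avoidanceLimit_not_exp_one h⟩

end Summit.CriticalPhenomena.SAWScalingLimit.Cruxes.AvoidanceLimit.SawCornerGerm

end
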